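import Literature.Probability.Percolation.VoronoiCrossing
import Literature.Probability.Percolation.CellQuad
import Literature.Probability.Percolation.QuadCrossingQuadTopology
import Summits.CriticalPhenomena.CardyFormulaZ2.Theorems.CardyFlipRussoTargetStubVoronoiCorner
import Summits.CriticalPhenomena.CardyFormulaZ2.Theorems.CardyFlipRussoVoronoiHubFromSmirnovReduction
import HarnessLib

/-!
# Towards stub `stub_voronoiBoundarySum` of line `Sketch` (crux `Target`, stmt-CriticalPhenomena-6431):
# continuum colour duality for Voronoi crossings of a conformal rectangle — the EXISTENCE half,
# and the exact identity isolating the exclusion term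

Helper file `--supports stmt-CriticalPhenomena-6431`.  The stub (Bollobás–Riordan, *Percolation*
(2006), Ch. 7, proof of Claim 23, p. 201: "`f_δ¹(z_δ) + f_δ²(z_δ) = 1 − o(1)`", transplanted to
ANNEALED Poisson–Voronoi percolation with paths in `closure Ω` and CLOSED colours
`blackRegion B W = {d_B ≤ d_W}`) needs, besides Tassion's one-arm estimate F1 and the colour
symmetry of the Poisson pair (`VoronoiColourSymmetry.lean`), the continuum analogue of
Bollobás–Riordan's Voronoi duality lemma (Ch. 8, Lemma 12, p. 275: "precisely one of the events
`H_b(R)` and `V_w(R)` holds") for a conformal rectangle `R = (Ω; a, b, c, d)` at mesh `δ > 0`: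

* (existence) if there is NO closed-black path in `closure Ω` from `(ab) = R.arc 0` to
  `(cd) = R.arc 2`, then there IS a strictly-white path (points with `d_W < d_B`, the complement of
  the closed black region) in `closure Ω` from `(bc) = R.arc 1` to `(da) = R.arc 3`;
* (exclusion) a closed-black `(ab) ↔ (cd)` path and a closed-WHITE `(bc) ↔ (da)` path do not
  coexist (almost surely / asymptotically).

This file PROVES the existence half, deterministically and for every pair of locally finite
configurations (`voronoi_strictDual_of_not_crossing`; with its trivial converse
`not_strictDual_of_voronoiCrossing` this is the exact dichotomy `voronoiCrossing_iff_not_strictDual`: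
**closed-black `(ab) ↔ (cd)` crossing XOR strictly-white `(bc) ↔ (da)` crossing**), from three
landed inputs: the dual-path theorem for quads (`Quad.exists_path_avoiding_of_not_crossed'`,
cut-wire + Janiszewski, read through a square model `exists_quad_of_conformalRectangle`), the
path-connectedness of the components of `closure Ω ∩ (black region)` (`joinedInConvexPieces` of the
crux `VoronoiHubFromSmirnov`, stmt-6433: Moore–Mazurkiewicz + convex pieces, here packaged as
`joinedIn_black_of_isPreconnected`), and the interlacing lemma
`ConformalRectangle.inter_nonempty_of_interlaced`.  Consequently, for EVERY probability law `P` on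
pairs of configurations (`measureReal_voronoiCrossing_add_strictDual`,
`measureReal_voronoiCrossing_add_whiteCrossing`):

`P[black (ab)↔(cd)] + P[strict-white (bc)↔(da)] = 1`, and
`P[black (ab)↔(cd)] + P[white (bc)↔(da)] = 1 + P[black (ab)↔(cd) ∧ white (bc)↔(da)]`,

so that the exclusion half is EXACTLY the statement that the last probability vanishes (as
`δ → 0⁺`): the typed blocker `VoronoiClosedCrossingsExclusion` of the worker's dossier.  (The
measurability these identities need is that of the closed-black crossing event only,
`stub_measurableCrossEvent`; the white event enters through Carathéodory's splitting
`measureReal_inter_add_sdiff`.)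
-/

noncomputable section

namespace Summit.CriticalPhenomena.CardyFormulaZ2.Theorems.CardyFlipRussoTarget

open MeasureTheory Filter Set Metric
open scoped Topology unitInterval
open Literature.Analysis.FunctionSpaces
open Literature.Probability.RandomPlanarGeometry
open Literature.Probability.Percolation
open Literature.Topology.PlaneTopology
open Summit.CriticalPhenomena.CardyFormulaZ2.Cruxes.VoronoiHubFromSmirnov.MoebiusExactDelaunayDilationWard
  (joinedInConvexPieces exists_convexPieces finite_black_of_snd_empty
    subsingleton_of_isPreconnected_of_finite stub_measurableCrossEvent crossEvent)

/-! ### Continua in the closed black region of `closure Ω` carry paths -/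

/-- **Continuum ⇒ path in the closed black region.**  For a Jordan domain `Ω`, a mesh `δ > 0` and
ANY pair `c = (black nuclei, white nuclei)` of locally finite configurations, two points of a
preconnected subset of `closure Ω ∩ {z | z/δ black}` are joined by a path inside that set: off the
junk cases (`c.1 = ∅`: everything is black; `c.2 = ∅ ≠ c.1`: finitely many black points) the black
region meets `closure Ω` in finitely many closed convex cells (`exists_convexPieces`) and the
components of a closed Jordan disc cut by finitely many convex bodies are path connected
(`joinedInConvexPieces`).  Adapted from `stub_measurableCrossEvent_of_joinedIn_convexPieces`. -/
theorem joinedIn_black_of_isPreconnected (Ω : JordanDomain) {δ : ℝ} (hδ : 0 < δ)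
    (c : PointConfig ℂ × PointConfig ℂ) {S : Set ℂ}
    (hS : S ⊆ closure Ω.carrier ∩ {z | z / (δ : ℂ) ∈ blackRegion (c.1 : Set ℂ) (c.2 : Set ℂ)})
    (hSc : IsPreconnected S) {x y : ℂ} (hx : x ∈ S) (hy : y ∈ S) :
    JoinedIn (closure Ω.carrier ∩ {z | z / (δ : ℂ) ∈ blackRegion (c.1 : Set ℂ) (c.2 : Set ℂ)}) x y := by
  rcases (c.1 : Set ℂ).eq_empty_or_nonempty with h1 | h1
  · -- every point is black
    have hB : {z : ℂ | z / (δ : ℂ) ∈ blackRegion (c.1 : Set ℂ) (c.2 : Set ℂ)} = univ := by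
      refine eq_univ_of_forall fun z => ?_
      rw [mem_setOf_eq, mem_blackRegion, h1, infDist_empty]
      exact infDist_nonneg
    have h𝒞 : ∀ C ∈ ({univ} : Set (Set ℂ)), IsClosed C ∧ Convex ℝ C ∧ (interior C).Nonempty := by
      intro C hC
      rw [mem_singleton_iff.1 hC, interior_univ]
      exact ⟨isClosed_univ, convex_univ, univ_nonempty⟩
    have key := joinedInConvexPieces Ω {univ} (finite_singleton _) h𝒞 S
      (by rw [sUnion_singleton, ← hB]; exact hS) hSc x hx y hy
    rwa [sUnion_singleton, ← hB] at key
  rcases (c.2 : Set ℂ).eq_empty_or_nonempty with h2 | h2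
  · -- finitely many black points: `S` is a point
    have hxy : x = y := subsingleton_of_isPreconnected_of_finite
      (finite_black_of_snd_empty Ω hδ c h1 h2) hS hSc hx hy
    subst hxy
    exact JoinedIn.refl (hS hx)
  · obtain ⟨𝒞, h𝒞f, h𝒞, hK⟩ := exists_convexPieces Ω hδ c h1 h2
    have hK' : closure Ω.carrier ∩ {z | z / (δ : ℂ) ∈ blackRegion (c.1 : Set ℂ) (c.2 : Set ℂ)} =
        closure Ω.carrier ∩ ⋃₀ 𝒞 := hK
    rw [hK'] at hS ⊢
    exact joinedInConvexPieces Ω 𝒞 h𝒞f h𝒞 S hS hSc x hx y hy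

/-! ### The dual path in a conformal rectangle -/

/-- **The dual path in a conformal rectangle.**  If a closed set `K` contains no connected subset of
`closure Ω ∩ K` meeting both `R.arc 0` and `R.arc 2`, then some path in `closure Ω ∖ K` joins
`R.arc 1` to `R.arc 3` (the quad dual-path theorem `Quad.exists_path_avoiding_of_not_crossed'` —
cut-wire + Janiszewski in a rectangle, transported by a square model — for the quad of `R`,
`CellComplex.exists_quad_of_conformalRectangle`, whose sides are `side k = R.arc (k + 3)`). -/
theorem ConformalRectangle.exists_joinedIn_diff_of_not_crossed (R : ConformalRectangle) {K : Set ℂ}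
    (hK : IsClosed K)
    (h : ∀ C ⊆ closure R.carrier ∩ K, IsPreconnected C → (C ∩ R.arc 0).Nonempty →
      (C ∩ R.arc 2).Nonempty → False) :
    ∃ x ∈ R.arc 1, ∃ y ∈ R.arc 3, JoinedIn (closure R.carrier \ K) x y := by
  obtain ⟨Q, hQc, hside⟩ := CellComplex.exists_quad_of_conformalRectangle (D := univ) R (subset_univ _)
  have hcpt : IsCompact (closure R.carrier ∩ K) := R.isBounded.isCompact_closure.inter_right hK
  have hs0 : Q.side 0 = R.arc 3 := hside 0
  have hs1 : Q.side 1 = R.arc 0 := by rw [hside 1]; rfl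
  have hs2 : Q.side 2 = R.arc 1 := by rw [hside 2]; rfl
  have hs3 : Q.side 3 = R.arc 2 := by rw [hside 3]; rfl
  obtain ⟨γ, hγc, hγm, hγ0, hγ1, hγK⟩ := Q.exists_path_avoiding_of_not_crossed' hcpt
    (hQc ▸ inter_subset_left) (fun C hC hCc hC1 hC3 =>
      h C hC hCc (hs1 ▸ hC1) (hs3 ▸ hC3))
  rw [hs0] at hγ0
  rw [hs2] at hγ1
  refine ⟨γ 1, hγ1, γ 0, hγ0, (JoinedIn.ofLine hγc rfl rfl ?_).symm⟩
  rintro _ ⟨t, ht, rfl⟩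
  have hmem : γ t ∈ closure R.carrier := hQc ▸ hγm ht
  exact ⟨hmem, fun hk => hγK t ht ⟨hmem, hk⟩⟩

/-! ### Colour duality, existence half: no closed-black crossing forces a strictly-white dual crossing -/

/-- **Continuum colour duality in a conformal rectangle, existence half** (the continuum analogue
of "one of `H_b(R)`, `V_w(R)` must hold", Bollobás–Riordan Ch. 8 Lemma 12, for a Jordan conformal
rectangle, paths in `closure Ω`, closed colours): at mesh `δ > 0`, for EVERY pair of locally finite
configurations, if no closed-black path joins `R.arc 0` to `R.arc 2` inside `closure Ω`, then a
STRICTLY white path (points `z` with `infDist (z/δ) W < infDist (z/δ) B`) joins `R.arc 1` to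
`R.arc 3` inside `closure Ω`.  Proof: by `joinedIn_black_of_isPreconnected` no black CONTINUUM
joins the two arcs either; apply the dual-path theorem to the closed black set. -/
theorem voronoi_strictDual_of_not_crossing (R : ConformalRectangle) {δ : ℝ} (hδ : 0 < δ)
    (c : PointConfig ℂ × PointConfig ℂ)
    (h : ¬ voronoiCrossing R.carrier (R.arc 0) (R.arc 2) δ (c.1 : Set ℂ) (c.2 : Set ℂ)) :
    ∃ x ∈ R.arc 1, ∃ y ∈ R.arc 3, JoinedIn (closure R.carrier ∩
      {z | infDist (z / (δ : ℂ)) (c.2 : Set ℂ) < infDist (z / (δ : ℂ)) (c.1 : Set ℂ)}) x y := by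
  have hKc : IsClosed {z : ℂ | z / (δ : ℂ) ∈ blackRegion (c.1 : Set ℂ) (c.2 : Set ℂ)} :=
    (isClosed_blackRegion _ _).preimage (continuous_id.div_const _)
  obtain ⟨x, hx, y, hy, hJ⟩ := ConformalRectangle.exists_joinedIn_diff_of_not_crossed R hKc
    (fun C hC hCc hC0 hC2 => by
      obtain ⟨a, haC, ha0⟩ := hC0
      obtain ⟨b, hbC, hb2⟩ := hC2
      exact h ⟨a, ha0, b, hb2, joinedIn_black_of_isPreconnected R.toJordanDomain hδ c hC hCc haC hbC⟩)
  refine ⟨x, hx, y, hy, hJ.mono ?_⟩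
  rintro z ⟨hz, hzK⟩
  have h' : ¬ infDist (z / (δ : ℂ)) (c.1 : Set ℂ) ≤ infDist (z / (δ : ℂ)) (c.2 : Set ℂ) := hzK
  exact ⟨hz, show infDist (z / (δ : ℂ)) (c.2 : Set ℂ) < infDist (z / (δ : ℂ)) (c.1 : Set ℂ) from
    not_le.1 h'⟩

/-- **Strict exclusion** (deterministic, every scale, all nucleus sets): a closed-black path from
`R.arc 0` to `R.arc 2` and a strictly-white path from `R.arc 1` to `R.arc 3`, both in `closure Ω`,
cannot coexist — their traces are interlaced continua, hence meet
(`ConformalRectangle.inter_nonempty_of_interlaced`), at a point both black and strictly white. -/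
theorem not_strictDual_of_voronoiCrossing (R : ConformalRectangle) {δ : ℝ} {B W : Set ℂ}
    (h : voronoiCrossing R.carrier (R.arc 0) (R.arc 2) δ B W)
    (h' : ∃ x ∈ R.arc 1, ∃ y ∈ R.arc 3, JoinedIn (closure R.carrier ∩
      {z | infDist (z / (δ : ℂ)) W < infDist (z / (δ : ℂ)) B}) x y) : False := by
  obtain ⟨a, ha, b, hb, hJ⟩ := h
  obtain ⟨x, hx, y, hy, hJ'⟩ := h'
  obtain ⟨p, hpK, hpL⟩ := ConformalRectangle.inter_nonempty_of_interlaced R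
    (isCompact_range hJ.somePath.continuous)
    (isConnected_range hJ.somePath.continuous).isPreconnected
    (fun _ ⟨t, ht⟩ => ht ▸ (hJ.somePath_mem t).1)
    ⟨a, ⟨0, hJ.somePath.source⟩, ha⟩ ⟨b, ⟨1, hJ.somePath.target⟩, hb⟩
    (isCompact_range hJ'.somePath.continuous)
    (isConnected_range hJ'.somePath.continuous).isPreconnected
    (fun _ ⟨t, ht⟩ => ht ▸ (hJ'.somePath_mem t).1)
    ⟨x, ⟨0, hJ'.somePath.source⟩, hx⟩ ⟨y, ⟨1, hJ'.somePath.target⟩, hy⟩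
  obtain ⟨t, rfl⟩ := hpK
  obtain ⟨s, hs⟩ := hpL
  have h1 : infDist (hJ.somePath t / (δ : ℂ)) B ≤ infDist (hJ.somePath t / (δ : ℂ)) W :=
    (hJ.somePath_mem t).2
  have h2 : infDist (hJ'.somePath s / (δ : ℂ)) W < infDist (hJ'.somePath s / (δ : ℂ)) B :=
    (hJ'.somePath_mem s).2
  rw [hs] at h2
  exact absurd h1 (not_le.2 h2)

/-- **The exact dichotomy** (continuum colour duality with an OPEN dual, every `δ > 0`, every pair
of locally finite configurations): `closure Ω` has a closed-black `R.arc 0 ↔ R.arc 2` crossing iff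
it has NO strictly-white `R.arc 1 ↔ R.arc 3` crossing. -/
theorem voronoiCrossing_iff_not_strictDual (R : ConformalRectangle) {δ : ℝ} (hδ : 0 < δ)
    (c : PointConfig ℂ × PointConfig ℂ) :
    voronoiCrossing R.carrier (R.arc 0) (R.arc 2) δ (c.1 : Set ℂ) (c.2 : Set ℂ) ↔
      ¬ ∃ x ∈ R.arc 1, ∃ y ∈ R.arc 3, JoinedIn (closure R.carrier ∩
        {z | infDist (z / (δ : ℂ)) (c.2 : Set ℂ) < infDist (z / (δ : ℂ)) (c.1 : Set ℂ)}) x y :=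
  ⟨fun h h' => not_strictDual_of_voronoiCrossing R h h',
    fun h' => by_contra fun h => h' (voronoi_strictDual_of_not_crossing R hδ c h)⟩

/-! ### The probability identities isolating the exclusion term -/

section Prob

variable (P : Measure (PointConfig ℂ × PointConfig ℂ)) [IsProbabilityMeasure P]
  (R : ConformalRectangle) {δ : ℝ}

/-- The closed-black crossing event of `R` at mesh `δ > 0` is measurable (it is the crux event
`crossEvent R δ` of stmt-6433, `stub_measurableCrossEvent`). -/
theorem measurableSet_voronoiCrossing (hδ : 0 < δ) :
    MeasurableSet {c : PointConfig ℂ × PointConfig ℂ |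
      voronoiCrossing R.carrier (R.arc 0) (R.arc 2) δ (c.1 : Set ℂ) (c.2 : Set ℂ)} :=
  stub_measurableCrossEvent R δ hδ

/-- **`P[black (ab)↔(cd)] + P[strictly-white (bc)↔(da)] = 1`** for every probability law `P` on
pairs of configurations and every mesh `δ > 0`: the two events are complementary
(`voronoiCrossing_iff_not_strictDual`) and the first is measurable. -/
theorem measureReal_voronoiCrossing_add_strictDual (hδ : 0 < δ) :
    P.real {c | voronoiCrossing R.carrier (R.arc 0) (R.arc 2) δ (c.1 : Set ℂ) (c.2 : Set ℂ)} +
      P.real {c : PointConfig ℂ × PointConfig ℂ | ∃ x ∈ R.arc 1, ∃ y ∈ R.arc 3,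
        JoinedIn (closure R.carrier ∩
          {z | infDist (z / (δ : ℂ)) (c.2 : Set ℂ) < infDist (z / (δ : ℂ)) (c.1 : Set ℂ)}) x y} = 1 := by
  have hcompl : {c : PointConfig ℂ × PointConfig ℂ | ∃ x ∈ R.arc 1, ∃ y ∈ R.arc 3,
      JoinedIn (closure R.carrier ∩
        {z | infDist (z / (δ : ℂ)) (c.2 : Set ℂ) < infDist (z / (δ : ℂ)) (c.1 : Set ℂ)}) x y} =
      {c | voronoiCrossing R.carrier (R.arc 0) (R.arc 2) δ (c.1 : Set ℂ) (c.2 : Set ℂ)}ᶜ := by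
    ext c
    rw [mem_compl_iff, mem_setOf_eq, mem_setOf_eq, voronoiCrossing_iff_not_strictDual R hδ c, not_not]
  rw [hcompl, measureReal_add_measureReal_compl (measurableSet_voronoiCrossing R hδ), probReal_univ]

/-- **`P[black (ab)↔(cd)] + P[white (bc)↔(da)] = 1 + P[black (ab)↔(cd) ∧ white (bc)↔(da)]`** for
every probability law `P` on pairs of configurations and every mesh `δ > 0` (white = CLOSED white,
`voronoiCrossing … (c.2) (c.1)`: at least as close to a white nucleus as to a black one).  Split the
white event along the measurable black event (Carathéodory, `measureReal_inter_add_sdiff`): off the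
black event, a closed-white crossing exists anyway, since even a strictly-white one does
(`voronoi_strictDual_of_not_crossing`).  With the colour symmetry
`IsPoissonPointProcess.measureReal_voronoiCrossing_swap` (two Poisson processes of one intensity)
the left side is `P[black (ab)↔(cd)] + P[black (bc)↔(da)]`, so the EXCLUSION half of continuum
colour duality — `P[black (ab)↔(cd) ∧ white (bc)↔(da)] → 0` — is exactly what the boundary sum
`f^{i+1} + f^{i+2} → 1` of stub `stub_voronoiBoundarySum` requires. -/
theorem measureReal_voronoiCrossing_add_whiteCrossing (hδ : 0 < δ) :
    P.real {c | voronoiCrossing R.carrier (R.arc 0) (R.arc 2) δ (c.1 : Set ℂ) (c.2 : Set ℂ)} +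
      P.real {c | voronoiCrossing R.carrier (R.arc 1) (R.arc 3) δ (c.2 : Set ℂ) (c.1 : Set ℂ)} =
      1 + P.real {c | voronoiCrossing R.carrier (R.arc 0) (R.arc 2) δ (c.1 : Set ℂ) (c.2 : Set ℂ) ∧
        voronoiCrossing R.carrier (R.arc 1) (R.arc 3) δ (c.2 : Set ℂ) (c.1 : Set ℂ)} := by
  set H : Set (PointConfig ℂ × PointConfig ℂ) :=
    {c | voronoiCrossing R.carrier (R.arc 0) (R.arc 2) δ (c.1 : Set ℂ) (c.2 : Set ℂ)} with hH
  set V : Set (PointConfig ℂ × PointConfig ℂ) :=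
    {c | voronoiCrossing R.carrier (R.arc 1) (R.arc 3) δ (c.2 : Set ℂ) (c.1 : Set ℂ)} with hV
  have hHm : MeasurableSet H := measurableSet_voronoiCrossing R hδ
  -- split `V` along `H`
  have hsplit : P.real (V ∩ H) + P.real (V \ H) = P.real V := measureReal_inter_add_sdiff hHm
  -- off `H`, a (strictly, hence closed) white dual crossing exists: `V \ H = Hᶜ`
  have hdiff : V \ H = Hᶜ := by
    ext c
    simp only [Set.mem_sdiff, mem_compl_iff, and_iff_right_iff_imp]
    intro hc
    obtain ⟨x, hx, y, hy, hJ⟩ := voronoi_strictDual_of_not_crossing R hδ c hc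
    exact ⟨x, hx, y, hy, hJ.mono (inter_subset_inter_right _ fun z hz => le_of_lt (α := ℝ) hz)⟩
  have hcompl : P.real H + P.real Hᶜ = 1 := by
    rw [measureReal_add_measureReal_compl hHm, probReal_univ]
  show P.real H + P.real V = 1 + P.real (H ∩ V)
  rw [inter_comm, hdiff] at hsplit
  linarith

end Prob

/-- **Registered sub-goal `voronoiBoundarySum_dualityIdentity`** of stub `stub_voronoiBoundarySum` (the
assembled identity, quantifiers closed): for every probability law `P` on pairs of configurations,
every conformal rectangle `R` and every mesh `δ > 0`,
`P[black (ab)↔(cd)] + P[white (bc)↔(da)] = 1 + P[black (ab)↔(cd) ∧ white (bc)↔(da)]`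
(`measureReal_voronoiCrossing_add_whiteCrossing`). [cite: BollobasRiordan2006, Ch. 8 Lemma 12 p. 275] -/
theorem voronoiBoundarySum_dualityIdentity : ∀ (P : MeasureTheory.Measure (Literature.Analysis.FunctionSpaces.PointConfig ℂ × Literature.Analysis.FunctionSpaces.PointConfig ℂ)) [MeasureTheory.IsProbabilityMeasure P] (R : Literature.Probability.RandomPlanarGeometry.ConformalRectangle) (δ : ℝ), 0 < δ → P.real {c | Literature.Probability.Percolation.voronoiCrossing R.carrier (R.arc 0) (R.arc 2) δ (c.1 : Set ℂ) (c.2 : Set ℂ)} + P.real {c | Literature.Probability.Percolation.voronoiCrossing R.carrier (R.arc 1) (R.arc 3) δ (c.2 : Set ℂ) (c.1 : Set ℂ)} = 1 + P.real {c | Literature.Probability.Percolation.voronoiCrossing R.carrier (R.arc 0) (R.arc 2) δ (c.1 : Set ℂ) (c.2 : Set ℂ) ∧ Literature.Probability.Percolation.voronoiCrossing R.carrier (R.arc 1) (R.arc 3) δ (c.2 : Set ℂ) (c.1 : Set ℂ)} :=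
  fun P _ R _ hδ => measureReal_voronoiCrossing_add_whiteCrossing P R hδ

end Summit.CriticalPhenomena.CardyFormulaZ2.Theorems.CardyFlipRussoTarget

end
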